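import Summits.BirchSwinnertonDyer.BirchSwinnertonDyer.Theorems.SchneiderFreeAdditiveX3SemistableTwistLocalNonAnomalous
import Summits.BirchSwinnertonDyer.Rank1Residual.GaloisImage.LagrangianPlaneTwoLines
import HarnessLib

/-!
# Route `SchneiderFreeAdditiveX3` (K1 door): the non-anomalous clause at an additive prime `p ≥ 5` of a
# semistable-twist curve holds for EVERY subgroup of order `p` of `E[p]` — not only for rational lines

Cell `bsd-schneider-ideate`, seat `bsd-schneider-door-c5` (prover, generation 24; assembly layer; `--supports` 19177).
PARTITION: board row B6 ∩ X3 ∩ sst-twist, `r = 1` (7 101 pairs; (G-ord, `e = 2`) half 2 560, (M) half 4 541), at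
`p ≥ 5`; types-the-object-of nothing new; supplies the LOCAL input under which cell `bsd-eis`'s kernel λ-count
(Keller–Yin 2024 Thm. 1.4.1 / CGLS 2022 Props. 1.4.1–1.4.2, files `…ResidualDevissageNonsplitLambdaIdentityOfFacts`,
`…XAcImprimitiveNoPTorsion`) applies to the door's curves (companion `…KYLambdaAlgImprimitiveOfPrintFiveLe`);
closes none of B6's cells (BSD NOT advanced).  bears_on: K1-door (items 18971/18972 → 19177 r3).

WHAT.  Generation 23 (`…SemistableTwistLocalNonAnomalous`, p663074) proved: for `E/ℚ` additive at `p ≥ 5` with a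
semistable quadratic twist `V = E^{(p*)}` and `E[p]` reducible, for every RATIONAL line `Φ ≤ E[p]` and every prime
`𝔓 ∣ p` of `\bar ℤ`, `D_𝔓` does not fix `Φ` pointwise and does not act trivially on `E[p]/Φ`.  The λ-count of cell
`bsd-eis` is keyed on a residual pair OVER `K`, whose line is `Γ_K`-stable but not a priori rational; its own
discharge at a non-split multiplicative prime (`…LambdaIdentityAtNonsplit.not_fix_and_not_quot_of_not_split_of_card_eq`)
is stated for EVERY subgroup `Φ ≤ E[p]` of order `p`.  This file upgrades generation 23's clause to that shape
by PLANE ALGEBRA, with no new local input: if `Φ₀` is a rational line carrying both clauses at a subgroup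
`D ≤ Γ_ℚ` and `Φ ≠ Φ₀` has order `p`, then `Φ ⊓ Φ₀ = 0`, `Φ + Φ₀ = E[p]`; were `D` to fix `Φ` pointwise,
`g•(a + b) − (a + b) = g•b − b ∈ Φ₀` for `a ∈ Φ`, `b ∈ Φ₀` would make `D` trivial on `E[p]/Φ₀`; were `D` trivial on
`E[p]/Φ`, then for `P ∈ Φ₀`, `g•P − P ∈ Φ ⊓ Φ₀ = 0` would make `D` fix `Φ₀` pointwise.

* §0 `inf_eq_bot_and_sup_eq_top_of_ne` — two distinct subgroups of order `p` of a group of order `p²` are complementary.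
* §1 `not_fix_and_not_quot_of_stableLine` — the transfer from ONE `D`-stable line to every line (any group `D ≤ Γ_ℚ`);
  `not_fix_and_not_quot_of_red_of_forall_isRationalLine` — from the clause for all rational lines plus `Red W p`.
* §2 cell forms at `p ≥ 5`, every `𝔓 ∣ p`, EVERY `Φ ≤ E[p]` with `#Φ = p`:
  `not_fix_and_not_quot_of_classX3_of_subGordTwo_of_card_eq` ((G-ord, `e = 2`)),
  `…_of_classX3_of_subM_of_card_eq` ((M)), `…_of_classX3_of_subSemistableTwist_of_card_eq` (both cells).

HONEST FRAMING: theorems only (finite group theory on the `𝔽_p`-plane `E[p]` over tree theorems); no definition, no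
named fact, no `sorry`; nothing about BSD or a main conjecture is asserted; at `p = 3` nothing is claimed; «closes rung:
none».  References: Serre, Invent. Math. 15 (1972) §1.11–1.12 [Serre1972]; Silverman *AEC* X.5 Cor. 5.4 [SilvermanAEC2009];
Castella–Grossi–Lee–Skinner, Invent. Math. 227 (2022) §1.2 (the hypothesis `θ|_{G_v̄} ∉ {𝟙, ω}`) [CastellaGrossiLeeSkinner2022];
Keller–Yin arXiv:2402.12781 Thm. 1.4.1 [KellerYin2024]; cell `bsd-eis` p649247 (the non-split twin).
-/

set_option autoImplicit false
set_option linter.dupNamespace false -- the summit namespace `…BirchSwinnertonDyer.BirchSwinnertonDyer.Theorems` (Sub = Summit, D-0017) trips it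

noncomputable section

open scoped Classical NumberField Pointwise

open WeierstrassCurve NumberField IsDedekindDomain Field
  Literature.NumberTheory.EllipticCurves Literature.NumberTheory.GaloisRepresentations
  Literature.NumberTheory.EllipticCurves.Rank1Residual
  Summit.BirchSwinnertonDyer.Rank1Residual Summit.BirchSwinnertonDyer.Rank1Residual.GaloisImage
  Summit.BirchSwinnertonDyer.Rank1Residual.Additive Summit.BirchSwinnertonDyer.Rank1Residual.AdditivePotMult

namespace Summit.BirchSwinnertonDyer.BirchSwinnertonDyer.Theorems.SchneiderFreeAdditiveX3.SemistableTwistLocalAnyLine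

/-! ### §0 Two distinct lines of the `𝔽_p`-plane are complementary -/

section Plane

/-- **Two distinct subgroups of prime order `p` of an abelian group of order `p²` meet trivially and generate.**
[folklore] -/
theorem inf_eq_bot_and_sup_eq_top_of_ne {H : Type*} [AddCommGroup H] {p : ℕ} (hp : p.Prime)
    (hH : Nat.card H = p ^ 2) {L M : AddSubgroup H} (hL : Nat.card L = p) (hM : Nat.card M = p) (hne : L ≠ M) :
    L ⊓ M = ⊥ ∧ L ⊔ M = ⊤ := by
  have hinf : L ⊓ M = ⊥ := by
    rcases LagrangianDichotomy.eq_or_inf_eq_bot_of_card_eq_prime hp L M hL hM with h | h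
    · exact absurd h.symm hne
    · exact h
  haveI : Finite H := Nat.finite_of_card_ne_zero (by rw [hH]; exact pow_ne_zero 2 hp.ne_zero)
  refine ⟨hinf, AddSubgroup.eq_top_of_card_eq _ ?_⟩
  have h := natCard_sup_mul_natCard_inf L M
  rw [hinf, AddSubgroup.card_bot, mul_one, hL, hM] at h
  rw [h, hH, sq]

end Plane

/-! ### §1 From ONE stable line carrying both clauses to every line -/

section Transfer

variable {W : WeierstrassCurve ℚ} [W.IsElliptic] {p : ℕ} [hp : Fact p.Prime]

/-- **Transfer of the non-anomalous clause from a stable line to every line.**  Let `D ≤ Γ_ℚ` be any subgroup and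
`Φ₀ ≤ E[p]` a `D`-stable subgroup of order `p` which `D` does not fix pointwise and on whose quotient `D` does not act
trivially.  Then the same two clauses hold for EVERY subgroup `Φ ≤ E[p]` of order `p`.  (If `Φ ≠ Φ₀` then
`Φ ⊓ Φ₀ = 0` and `Φ + Φ₀ = E[p]`: a pointwise-fixed `Φ` would make `D` trivial on `E[p]/Φ₀`, and a quotient `E[p]/Φ`
with trivial `D`-action would make `D` fix `Φ₀` pointwise, `g•P − P ∈ Φ ⊓ Φ₀`.)  [folklore] -/
theorem not_fix_and_not_quot_of_stableLine (D : Subgroup (absoluteGaloisGroup ℚ))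
    {Φ₀ : AddSubgroup (geomTorsion W (p : ℤ))} (hΦ₀ : Nat.card Φ₀ = p)
    (hstab : ∀ g ∈ D, ∀ P ∈ Φ₀, g • P ∈ Φ₀)
    (h₀ : (¬ ∀ g ∈ D, ∀ P ∈ Φ₀, g • P = P) ∧
      (¬ ∀ g ∈ D, ∀ P : geomTorsion W (p : ℤ), g • P - P ∈ Φ₀))
    {Φ : AddSubgroup (geomTorsion W (p : ℤ))} (hΦ : Nat.card Φ = p) :
    (¬ ∀ g ∈ D, ∀ P ∈ Φ, g • P = P) ∧
      (¬ ∀ g ∈ D, ∀ P : geomTorsion W (p : ℤ), g • P - P ∈ Φ) := by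
  have hpP : p.Prime := hp.out
  by_cases heq : Φ = Φ₀
  · subst heq; exact h₀
  obtain ⟨hinf, hsup⟩ := inf_eq_bot_and_sup_eq_top_of_ne hpP (Rank1Residual.natCard_geomTorsion W p) hΦ hΦ₀ heq
  refine ⟨fun hfix ↦ h₀.2 fun g hg P ↦ ?_, fun hq ↦ h₀.1 fun g hg P hP ↦ ?_⟩
  · -- `P = a + b`, `a ∈ Φ` fixed by `g`, `b ∈ Φ₀` stable: `g•P - P = g•b - b ∈ Φ₀`
    have hP : P ∈ Φ ⊔ Φ₀ := by rw [hsup]; exact AddSubgroup.mem_top P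
    obtain ⟨a, ha, b, hb, rfl⟩ := AddSubgroup.mem_sup.mp hP
    have h1 : g • (a + b) - (a + b) = g • b - b := by
      rw [smul_add, hfix g hg a ha]; abel
    rw [h1]
    exact Φ₀.sub_mem (hstab g hg b hb) hb
  · -- `g•P - P ∈ Φ ⊓ Φ₀ = ⊥`
    have h1 : g • P - P ∈ Φ ⊓ Φ₀ := ⟨hq g hg P, Φ₀.sub_mem (hstab g hg P hP) hP⟩
    rw [hinf, AddSubgroup.mem_bot] at h1
    exact sub_eq_zero.mp h1

/-- **The clause for every line from the clause for all RATIONAL lines**, given that `E[p]` is reducible (`Red W p`, so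
that a rational line exists).  `D ≤ Γ_ℚ` arbitrary (a decomposition group above `p` in the applications). [folklore] -/
theorem not_fix_and_not_quot_of_red_of_forall_isRationalLine (hred : Red W p) (D : Subgroup (absoluteGaloisGroup ℚ))
    (h : ∀ Φ₀ : AddSubgroup (geomTorsion W (p : ℤ)), IsRationalLine W p Φ₀ →
      (¬ ∀ g ∈ D, ∀ P ∈ Φ₀, g • P = P) ∧
        (¬ ∀ g ∈ D, ∀ P : geomTorsion W (p : ℤ), g • P - P ∈ Φ₀))
    {Φ : AddSubgroup (geomTorsion W (p : ℤ))} (hΦ : Nat.card Φ = p) :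
    (¬ ∀ g ∈ D, ∀ P ∈ Φ, g • P = P) ∧
      (¬ ∀ g ∈ D, ∀ P : geomTorsion W (p : ℤ), g • P - P ∈ Φ) := by
  obtain ⟨Φ₀, hΦ₀⟩ := exists_isRationalLine_of_not_irr W p hred
  exact not_fix_and_not_quot_of_stableLine D hΦ₀.1 (fun g _ P hP ↦ hΦ₀.2 g P hP) (h Φ₀ hΦ₀) hΦ

end Transfer

/-! ### §2 Cell forms at `p ≥ 5`: every prime above `p`, EVERY subgroup of order `p` of `E[p]` -/

section Classes

variable (W : WeierstrassCurve ℚ) [W.IsElliptic] [W.IsGloballyMinimal] (p : ℕ) [hp : Fact p.Prime]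

/-- **The (G-ord, `e = 2`) cell of B6 ∩ X3 at `p ≥ 5`, every `𝔓 ∣ p`, EVERY `Φ ≤ E[p]` with `#Φ = p` (no stability
assumed): `D_𝔓` neither fixes `Φ` pointwise nor acts trivially on `E[p]/Φ`.**  Generation 23's rational-line clause
(`SemistableTwistLocal.not_fix_and_not_quot_of_classX3_of_subGordTwo`) transferred by §1 (`ClassX3` supplies `Red`).
[cite: Serre1972, §1.11 Prop. 11] [cite: SilvermanAEC2009, X.5 Cor. 5.4]
[cite: CastellaGrossiLeeSkinner2022, §1.2 (hypothesis θ|_{G_v̄} ≠ 𝟙, ω)] -/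
theorem not_fix_and_not_quot_of_classX3_of_subGordTwo_of_card_eq (hp5 : 5 ≤ p) (hX : ClassX3 W p)
    (hSG : SubGordTwo W p)
    {v : HeightOneSpectrum (𝓞 ℚ)} (hpv : ((p : ℕ) : 𝓞 ℚ) ∈ v.asIdeal)
    {𝔓 : Ideal (absIntegers (𝓞 ℚ) ℚ)} (h𝔓 : 𝔓 ∈ v.primesAbove)
    {Φ : AddSubgroup (geomTorsion W (p : ℤ))} (hΦ : Nat.card Φ = p) :
    (¬ ∀ g ∈ 𝔓.decompositionSubgroup (absoluteGaloisGroup ℚ), ∀ P ∈ Φ, g • P = P) ∧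
      (¬ ∀ g ∈ 𝔓.decompositionSubgroup (absoluteGaloisGroup ℚ),
        ∀ P : geomTorsion W (p : ℤ), g • P - P ∈ Φ) :=
  not_fix_and_not_quot_of_red_of_forall_isRationalLine hX.1 _
    (fun _ hΦ₀ ↦ SemistableTwistLocal.not_fix_and_not_quot_of_classX3_of_subGordTwo W p hp5 hX hSG hpv h𝔓 hΦ₀) hΦ

omit [W.IsGloballyMinimal] in
/-- **The (M) cell of B6 ∩ X3 at `p ≥ 5`, every `𝔓 ∣ p`, EVERY `Φ ≤ E[p]` with `#Φ = p`.**  Generation 23's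
rational-line clause (`SemistableTwistLocal.not_fix_and_not_quot_of_classX3_of_subM`, Tate uniformisation PROVED)
transferred by §1. [cite: SilvermanATAEC1994, Ch. V Thm. 5.3, Cor. 5.4] [cite: SilvermanAEC2009, X.5 Cor. 5.4] -/
theorem not_fix_and_not_quot_of_classX3_of_subM_of_card_eq (hp5 : 5 ≤ p) (hX : ClassX3 W p) (hSM : SubM W p)
    {v : HeightOneSpectrum (𝓞 ℚ)} (hpv : ((p : ℕ) : 𝓞 ℚ) ∈ v.asIdeal)
    {𝔓 : Ideal (absIntegers (𝓞 ℚ) ℚ)} (h𝔓 : 𝔓 ∈ v.primesAbove)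
    {Φ : AddSubgroup (geomTorsion W (p : ℤ))} (hΦ : Nat.card Φ = p) :
    (¬ ∀ g ∈ 𝔓.decompositionSubgroup (absoluteGaloisGroup ℚ), ∀ P ∈ Φ, g • P = P) ∧
      (¬ ∀ g ∈ 𝔓.decompositionSubgroup (absoluteGaloisGroup ℚ),
        ∀ P : geomTorsion W (p : ℤ), g • P - P ∈ Φ) :=
  not_fix_and_not_quot_of_red_of_forall_isRationalLine hX.1 _
    (fun _ hΦ₀ ↦ SemistableTwistLocal.not_fix_and_not_quot_of_classX3_of_subM W p hp5 hX hSM hpv h𝔓 hΦ₀) hΦ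

/-- **The semistable-twist cells of B6 ∩ X3 at `p ≥ 5`** (`SubSemistableTwist = SubM ∨ SubGordTwo`), every `𝔓 ∣ p`,
EVERY `Φ ≤ E[p]` with `#Φ = p`: the non-anomalous clause.  This is the shape consumed by cell `bsd-eis`'s λ-count
(`…LambdaIdentityAtNonsplit.localData_of_not_split` takes its non-split twin).
[cite: Serre1972, §1.11 Prop. 11 and §1.12 Prop. 13] [cite: SilvermanAEC2009, X.5 Cor. 5.4] -/
theorem not_fix_and_not_quot_of_classX3_of_subSemistableTwist_of_card_eq (hp5 : 5 ≤ p) (hX : ClassX3 W p)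
    (hS : SubSemistableTwist W p)
    {v : HeightOneSpectrum (𝓞 ℚ)} (hpv : ((p : ℕ) : 𝓞 ℚ) ∈ v.asIdeal)
    {𝔓 : Ideal (absIntegers (𝓞 ℚ) ℚ)} (h𝔓 : 𝔓 ∈ v.primesAbove)
    {Φ : AddSubgroup (geomTorsion W (p : ℤ))} (hΦ : Nat.card Φ = p) :
    (¬ ∀ g ∈ 𝔓.decompositionSubgroup (absoluteGaloisGroup ℚ), ∀ P ∈ Φ, g • P = P) ∧
      (¬ ∀ g ∈ 𝔓.decompositionSubgroup (absoluteGaloisGroup ℚ),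
        ∀ P : geomTorsion W (p : ℤ), g • P - P ∈ Φ) :=
  not_fix_and_not_quot_of_red_of_forall_isRationalLine hX.1 _
    (fun _ hΦ₀ ↦ SemistableTwistLocal.not_fix_and_not_quot_of_classX3_of_subSemistableTwist W p hp5 hX hS hpv h𝔓 hΦ₀)
    hΦ

end Classes

end Summit.BirchSwinnertonDyer.BirchSwinnertonDyer.Theorems.SchneiderFreeAdditiveX3.SemistableTwistLocalAnyLine

end
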